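import Summits.BirchSwinnertonDyer.BirchSwinnertonDyer.Theorems.ClassRecordThreeEulerHalvesAtThreeCartanTorusCubeCutCuspCharModThree
import HarnessLib

/-!
# Crux 19109 `EulerHalvesAtThree` ∕ 23422 line `cartan` v8′, stub (F2a): the TORUS-CUBE CUT of S-K1′ — towards input (C2):
# root counts of `s·t` summed over the split torus (`Σ_{s ∈ T_s} rootCount(s t) = (q − 1)·N(t)`), the values of `N(t)`, and the
# scalar pairs

Seat `bsd-stepL-tam3-p1` g21 (LINE OWNER of crux 23422; `--supports stmt-BirchSwinnertonDyer-23422 --as helper`). CONTENT, all PROVED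
(`q ≥ 5` prime; the Bonnafé-free, `P¹`-free evaluation of `S₃ (mod 3)`):
* §1 `x² − tr M·x + det M = det(M − x·1)` and, for `s ∈ T_s` diagonal, `det(st − x·1) = det s · det(t − x·s⁻¹)`; summing over the split
  torus and substituting `w = x·u⁻¹`: **`Σ_{s ∈ T_s} rootCount(s·t) = (q − 1)·N(t)`** (`sum_rootCount_splitTorus`) with
  `N(t) = diagCount t = #{(a,b) ∈ (𝔽_q^×)² : det(t − diag(a,b)) = 0}`;
* §2 `N(c·1) = 2q − 3` (`diagCount_scalar`) and `N(t) = q − 3` for `t` with all four entries non-zero and `det t ≠ t₀₀t₁₁`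
  (`diagCount_generic`: the solutions of `(t₀₀ − a)(t₁₁ − b) = t₀₁t₁₀` in units are parametrised by `a ∉ {0, t₀₀, det t / t₁₁}`);
* §3 for `s ∈ T_s`, `t ∈ T_C`: `s·t` is scalar iff both are (`isScalarMat_mul_iff`), and the number of such pairs in `T_s × T_C³` is
  `(q − 1)²` (`card_scalar_pairs`).
HONEST FRAMING: finite-field counting in `GL₂(𝔽_q)`; nothing about any curve, `L`-value or period; S-K1′ is NOT proved here (inputs (C2),
(P1)–(P3) of the cut remain at this file); no summit statement, no route item and no registered stub is proved; BSD is proved for no curve.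
[folklore; background: cite: Bump1997, §4.1]
-/

namespace Summit.BirchSwinnertonDyer.BirchSwinnertonDyer.Theorems.CartanTorusCubeCut

open Summit.BirchSwinnertonDyer.BirchSwinnertonDyer.Theorems.CartanDegree

open scoped Classical

set_option linter.dupNamespace false
set_option autoImplicit false

noncomputable section

variable {q : ℕ} [Fact q.Prime]

/-! ### §1 Root counts of `s·t` over the split torus -/

/-- `det(M − x·1) = x² − tr M·x + det M` (`2 × 2`). -/
theorem det_sub_smul_one (M : Mat q) (x : ZMod q) :
    (M - x • (1 : Mat q)).det = x * x - M.trace * x + M.det := by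
  simp only [Matrix.det_fin_two, Matrix.trace_fin_two, Matrix.sub_apply, Matrix.smul_apply, Matrix.one_apply_eq,
    Matrix.one_apply_ne (by decide : (0 : Fin 2) ≠ 1), Matrix.one_apply_ne (by decide : (1 : Fin 2) ≠ 0), smul_eq_mul,
    mul_one, mul_zero, sub_zero]
  ring

/-- `rootCount M = #{x : det(M − x·1) = 0}`. -/
theorem rootCount_eq_card_det (M : Mat q) :
    rootCount M = (Finset.univ.filter (fun x : ZMod q => (M - x • (1 : Mat q)).det = 0)).card := by
  rw [rootCount]
  congr 1
  ext x
  simp only [Finset.mem_filter, Finset.mem_univ, true_and, det_sub_smul_one]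
  constructor <;> intro h <;> linear_combination h

/-- the diagonal count `N(t) = #{(a,b) ∈ (𝔽_q^×)² : det(t − diag(a,b)) = 0}`. -/
def diagCount (t : Mat q) : ℕ :=
  (Finset.univ.filter (fun p : (ZMod q)ˣ × (ZMod q)ˣ =>
    (t - Matrix.diagonal ![(p.1 : ZMod q), (p.2 : ZMod q)]).det = 0)).card

/-- the matrix of `(diagGL u)⁻¹` is the diagonal of the inverses. -/
theorem diagGL_inv_coe (u : Fin 2 → (ZMod q)ˣ) :
    (((diagGL u)⁻¹ : G q) : Mat q) = Matrix.diagonal (fun i => ((u i)⁻¹ : (ZMod q)ˣ) : Fin 2 → ZMod q) := by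
  apply Units.inv_eq_of_mul_eq_one_right
  rw [diagGL_coe, Matrix.diagonal_mul_diagonal, ← Matrix.diagonal_one]
  congr 1
  funext i
  exact Units.mul_inv (u i)

/-- for a diagonal unit `s = diag(u)` and `x ≠ 0`: `det(s·t − x·1) = 0 ↔ det(t − diag(x·u⁻¹)) = 0`. -/
theorem det_diag_mul_sub_iff (u : Fin 2 → (ZMod q)ˣ) (t : Mat q) (x : ZMod q) :
    ((diagGL u : G q) * t - x • (1 : Mat q)).det = 0 ↔
      (t - Matrix.diagonal ![x * ((u 0)⁻¹ : (ZMod q)ˣ), x * ((u 1)⁻¹ : (ZMod q)ˣ)]).det = 0 := by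
  have hfac : ((diagGL u : G q) : Mat q) * t - x • (1 : Mat q) =
      ((diagGL u : G q) : Mat q) * (t - Matrix.diagonal ![x * ((u 0)⁻¹ : (ZMod q)ˣ), x * ((u 1)⁻¹ : (ZMod q)ˣ)]) := by
    rw [mul_sub, diagGL_coe, Matrix.diagonal_mul_diagonal, Matrix.smul_one_eq_diagonal]
    congr 2
    funext i
    fin_cases i
    · show x = (u 0 : ZMod q) * (x * ((u 0)⁻¹ : (ZMod q)ˣ))
      rw [mul_left_comm, Units.mul_inv, mul_one]
    · show x = (u 1 : ZMod q) * (x * ((u 1)⁻¹ : (ZMod q)ˣ))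
      rw [mul_left_comm, Units.mul_inv, mul_one]
  rw [hfac, Matrix.det_mul]
  have hdet : (((diagGL u : G q) : Mat q)).det ≠ 0 := by
    have hu : IsUnit (((diagGL u : G q) : Mat q)).det := by
      rw [← Matrix.isUnit_iff_isUnit_det]; exact Units.isUnit _
    exact hu.ne_zero
  constructor
  · intro h
    rcases mul_eq_zero.1 h with h0 | h0
    · exact absurd h0 hdet
    · exact h0
  · intro h; rw [h, mul_zero]

/-- for `x ≠ 0`, `#{u : det(diag(u)·t − x·1) = 0} = N(t)` (substitute `(a,b) = (x u₀⁻¹, x u₁⁻¹)`). -/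
theorem card_diag_roots_eq_diagCount (t : Mat q) {x : ZMod q} (hx : x ≠ 0) :
    (Finset.univ.filter (fun u : Fin 2 → (ZMod q)ˣ =>
      (((diagGL u : G q) : Mat q) * t - x • (1 : Mat q)).det = 0)).card = diagCount t := by
  set ν : (ZMod q)ˣ := Units.mk0 x hx with hν
  -- the substitution as an equivalence
  let e : (Fin 2 → (ZMod q)ˣ) ≃ (ZMod q)ˣ × (ZMod q)ˣ :=
    { toFun := fun u => (ν * (u 0)⁻¹, ν * (u 1)⁻¹)
      invFun := fun p => ![ν * p.1⁻¹, ν * p.2⁻¹]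
      left_inv := by
        intro u; funext i; fin_cases i <;> simp
      right_inv := by
        intro p; ext <;> simp }
  rw [diagCount]
  apply Finset.card_equiv e
  intro u
  simp only [Finset.mem_filter, Finset.mem_univ, true_and]
  rw [det_diag_mul_sub_iff]
  have h1 : (x * ((u 0)⁻¹ : (ZMod q)ˣ) : ZMod q) = ((e u).1 : ZMod q) := by
    show x * _ = ((ν * (u 0)⁻¹ : (ZMod q)ˣ) : ZMod q)
    rw [Units.val_mul, hν, Units.val_mk0]
  have h2 : (x * ((u 1)⁻¹ : (ZMod q)ˣ) : ZMod q) = ((e u).2 : ZMod q) := by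
    show x * _ = ((ν * (u 1)⁻¹ : (ZMod q)ˣ) : ZMod q)
    rw [Units.val_mul, hν, Units.val_mk0]
  rw [h1, h2]

/-- **`Σ_{s ∈ T_s} rootCount(s·t) = (q − 1)·N(t)`** for every invertible `t`. -/
theorem sum_rootCount_splitTorus (t : G q) :
    ∑ s ∈ splitTorus q, rootCount ((s * t : G q) : Mat q) = (q - 1) * diagCount (t : Mat q) := by
  rw [splitTorus_eq_image, Finset.sum_image (fun a _ b _ h => diagGL_injective h)]
  simp only [rootCount_eq_card_det, Units.val_mul, Finset.card_filter]
  rw [Finset.sum_comm]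
  -- split `x = 0` from the rest
  rw [← Finset.sum_erase_add _ _ (Finset.mem_univ (0 : ZMod q))]
  have h0 : ∑ u : Fin 2 → (ZMod q)ˣ, (if (((diagGL u : G q) : Mat q) * (t : Mat q) - (0 : ZMod q) • (1 : Mat q)).det = 0
      then 1 else 0) = 0 := by
    apply Finset.sum_eq_zero
    intro u _
    rw [if_neg]
    rw [zero_smul, sub_zero, ← Units.val_mul]
    have hu : IsUnit (((diagGL u * t : G q) : Mat q)).det := by
      rw [← Matrix.isUnit_iff_isUnit_det]; exact Units.isUnit _
    exact hu.ne_zero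
  rw [h0, add_zero]
  have hx : ∀ x ∈ (Finset.univ : Finset (ZMod q)).erase 0,
      ∑ u : Fin 2 → (ZMod q)ˣ, (if (((diagGL u : G q) : Mat q) * (t : Mat q) - x • (1 : Mat q)).det = 0 then 1 else 0)
        = diagCount (t : Mat q) := by
    intro x hx
    have hx0 : x ≠ 0 := (Finset.mem_erase.1 hx).1
    rw [← Finset.card_filter]
    exact card_diag_roots_eq_diagCount (t : Mat q) hx0
  rw [Finset.sum_congr rfl hx, Finset.sum_const, Finset.card_erase_of_mem (Finset.mem_univ _), Finset.card_univ,
    ZMod.card, smul_eq_mul]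

/-! ### §2 The values of `N(t)` -/

/-- `det(t − diag(a,b)) = (t₀₀ − a)(t₁₁ − b) − t₀₁t₁₀`. -/
theorem det_sub_diagonal (t : Mat q) (a b : ZMod q) :
    (t - Matrix.diagonal ![a, b]).det = (t 0 0 - a) * (t 1 1 - b) - t 0 1 * t 1 0 := by
  simp [Matrix.det_fin_two, Matrix.sub_apply, Matrix.diagonal]

/-- **`N(c·1) = 2q − 3`** for a unit `c`. -/
theorem diagCount_scalar {c : ZMod q} (hc : c ≠ 0) : diagCount (c • (1 : Mat q)) = 2 * q - 3 := by
  set cu : (ZMod q)ˣ := Units.mk0 c hc with hcu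
  have hset : (Finset.univ.filter (fun p : (ZMod q)ˣ × (ZMod q)ˣ =>
      (c • (1 : Mat q) - Matrix.diagonal ![(p.1 : ZMod q), (p.2 : ZMod q)]).det = 0))
      = ({cu} ×ˢ Finset.univ) ∪ (Finset.univ ×ˢ {cu}) := by
    ext p
    simp only [Finset.mem_filter, Finset.mem_univ, true_and, Finset.mem_union, Finset.mem_product,
      Finset.mem_singleton, and_true, det_sub_diagonal, Matrix.smul_apply, Matrix.one_apply_eq,
      Matrix.one_apply_ne (by decide : (0 : Fin 2) ≠ 1), Matrix.one_apply_ne (by decide : (1 : Fin 2) ≠ 0),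
      smul_eq_mul, mul_one, mul_zero, sub_zero, mul_eq_zero]
    rw [sub_eq_zero, sub_eq_zero, hcu]
    constructor
    · rintro (h | h)
      · left; exact Units.ext (by rw [Units.val_mk0]; exact h.symm)
      · right; exact Units.ext (by rw [Units.val_mk0]; exact h.symm)
    · rintro (h | h)
      · left; rw [h, Units.val_mk0]
      · right; rw [h, Units.val_mk0]
  rw [diagCount, hset]
  have hinter : (({cu} : Finset (ZMod q)ˣ) ×ˢ (Finset.univ : Finset (ZMod q)ˣ)) ∩
      ((Finset.univ : Finset (ZMod q)ˣ) ×ˢ ({cu} : Finset (ZMod q)ˣ)) =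
        ({cu} : Finset (ZMod q)ˣ) ×ˢ ({cu} : Finset (ZMod q)ˣ) := by
    rw [Finset.product_inter_product, Finset.singleton_inter_of_mem (Finset.mem_univ _),
      Finset.inter_singleton_of_mem (Finset.mem_univ _)]
  have hcard := Finset.card_union_add_card_inter (({cu} : Finset (ZMod q)ˣ) ×ˢ (Finset.univ : Finset (ZMod q)ˣ))
    ((Finset.univ : Finset (ZMod q)ˣ) ×ˢ ({cu} : Finset (ZMod q)ˣ))
  rw [hinter, Finset.card_product, Finset.card_product, Finset.card_product, Finset.card_singleton,
    Finset.card_univ, ZMod.card_units] at hcard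
  have hq : 1 ≤ q := (Fact.out : q.Prime).one_le
  omega

/-- **`N(t) = q − 3`** for `t` with `t₀₀, t₁₁, t₀₁t₁₀ ≠ 0` and `det t ≠ 0` (the non-scalar cubes of (C2)): the solutions of
`(t₀₀ − a)(t₁₁ − b) = t₀₁t₁₀` in units are `a ∉ {0, t₀₀, det t / t₁₁}`, `b` determined. -/
theorem diagCount_generic {t : Mat q} (h00 : t 0 0 ≠ 0) (h11 : t 1 1 ≠ 0) (hk : t 0 1 * t 1 0 ≠ 0)
    (hdet : t.det ≠ 0) : diagCount t = q - 3 := by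
  set S := Finset.univ.filter (fun p : (ZMod q)ˣ × (ZMod q)ˣ =>
    (t - Matrix.diagonal ![(p.1 : ZMod q), (p.2 : ZMod q)]).det = 0) with hS
  set F : Finset (ZMod q) := Finset.univ \ {0, t 0 0, t.det * (t 1 1)⁻¹} with hF
  have hdet2 : t.det = t 0 0 * t 1 1 - t 0 1 * t 1 0 := Matrix.det_fin_two t
  have hmemS : ∀ p : (ZMod q)ˣ × (ZMod q)ˣ, p ∈ S ↔ (t 0 0 - p.1) * (t 1 1 - p.2) = t 0 1 * t 1 0 := by
    intro p
    rw [hS, Finset.mem_filter, det_sub_diagonal]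
    simp only [Finset.mem_univ, true_and]
    exact sub_eq_zero
  -- projection to the first coordinate is injective on `S` with image `F`
  have himage : S.image (fun p => (p.1 : ZMod q)) = F := by
    ext a
    simp only [Finset.mem_image, hF, Finset.mem_sdiff, Finset.mem_univ, true_and, Finset.mem_insert,
      Finset.mem_singleton, not_or]
    constructor
    · rintro ⟨p, hp, rfl⟩
      rw [hmemS] at hp
      refine ⟨p.1.ne_zero, ?_, ?_⟩
      · intro ha
        rw [← ha, sub_self, zero_mul] at hp
        exact hk hp.symm
      · intro ha
        -- then t₁₁ - b = t₁₁, so b = 0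
        have hb : (t 0 0 - (p.1 : ZMod q)) = t 0 1 * t 1 0 * (t 1 1)⁻¹ := by
          rw [ha, hdet2]; field_simp; ring
        rw [hb] at hp
        have : (p.2 : ZMod q) = 0 := by
          have e : t 0 1 * t 1 0 * ((t 1 1)⁻¹ * (t 1 1 - (p.2 : ZMod q)) - 1) = 0 := by
            linear_combination hp
          rcases mul_eq_zero.1 e with e1 | e1
          · exact absurd e1 hk
          · have : (t 1 1)⁻¹ * (t 1 1 - (p.2 : ZMod q)) = 1 := sub_eq_zero.1 e1
            have h2 : t 1 1 - (p.2 : ZMod q) = t 1 1 := by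
              have := congrArg (fun z => t 1 1 * z) this
              simp only [← mul_assoc, mul_inv_cancel₀ h11, one_mul, mul_one] at this
              exact this
            linear_combination -h2
        exact p.2.ne_zero this
    · rintro ⟨ha0, ha, had⟩
      have hm : t 0 0 - a ≠ 0 := sub_ne_zero.2 (Ne.symm ha)
      set b : ZMod q := t 1 1 - t 0 1 * t 1 0 * (t 0 0 - a)⁻¹ with hb
      have hb0 : b ≠ 0 := by
        intro hb0
        apply had
        have e : t 1 1 * (t 0 0 - a) = t 0 1 * t 1 0 := by
          have := congrArg (fun z => z * (t 0 0 - a)) hb0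
          simp only [hb, sub_mul, mul_assoc, inv_mul_cancel₀ hm, mul_one, zero_mul] at this
          linear_combination this
        rw [hdet2]
        field_simp
        linear_combination -e
      refine ⟨(Units.mk0 a ha0, Units.mk0 b hb0), ?_, by simp⟩
      rw [hmemS]
      simp only [Units.val_mk0, hb]
      field_simp
      ring
  have hinj : Set.InjOn (fun p : (ZMod q)ˣ × (ZMod q)ˣ => (p.1 : ZMod q)) (S : Set ((ZMod q)ˣ × (ZMod q)ˣ)) := by
    intro p hp p' hp' h
    simp only [Finset.mem_coe] at hp hp'
    rw [hmemS] at hp hp'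
    simp only at h
    have h1 : p.1 = p'.1 := Units.ext h
    have hm : t 0 0 - (p.1 : ZMod q) ≠ 0 := by
      intro h0; rw [h0, zero_mul] at hp; exact hk hp.symm
    have h2 : (p.2 : ZMod q) = (p'.2 : ZMod q) := by
      rw [← h] at hp'
      have := hp.trans hp'.symm
      have e := mul_left_cancel₀ hm this
      linear_combination -e
    exact Prod.ext h1 (Units.ext h2)
  have h3 : ({0, t 0 0, t.det * (t 1 1)⁻¹} : Finset (ZMod q)).card = 3 := by
    have h1 : (0 : ZMod q) ≠ t 0 0 := h00.symm
    have h2 : (0 : ZMod q) ≠ t.det * (t 1 1)⁻¹ := (mul_ne_zero hdet (inv_ne_zero h11)).symm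
    have h3' : t 0 0 ≠ t.det * (t 1 1)⁻¹ := by
      intro h
      apply hk
      have := congrArg (fun z => z * t 1 1) h
      simp only [mul_assoc, inv_mul_cancel₀ h11, mul_one] at this
      rw [hdet2] at this
      linear_combination this
    rw [Finset.card_insert_of_notMem, Finset.card_insert_of_notMem, Finset.card_singleton]
    · simpa using h3'
    · simp [h1, h2]
  rw [diagCount, ← hS, ← Finset.card_image_of_injOn hinj, himage, hF, Finset.card_sdiff, Finset.inter_univ,
    Finset.card_univ, ZMod.card, h3]

/-! ### §3 Scalar pairs -/

/-- an element of `T_C` with vanishing upper-right entry is scalar. -/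
theorem isScalarMat_of_mem_torus_of_entry01 {η : Mat q} (hη : ¬ HasRatEigenvalue η) {t : G q}
    (ht : t ∈ nonsplitTorus η) (h01 : (t : Mat q) 0 1 = 0) : IsScalarMat (t : Mat q) := by
  have htlin := lin_coord_of_mem hη (mem_nonsplitTorus_iff.1 ht)
  rw [← htlin]
  apply (isScalarMat_lin_iff hη _).2
  rw [← htlin] at h01
  simp only [lin, Matrix.add_apply, Matrix.smul_apply, Matrix.one_apply_ne (by decide : (0 : Fin 2) ≠ 1), smul_eq_mul,
    mul_zero, zero_add] at h01
  rcases mul_eq_zero.1 h01 with h | h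
  · exact h
  · exact absurd h (entry01_ne_zero hη)

/-- **for `s ∈ T_s`, `t ∈ T_C`: `s·t` is scalar iff `s` and `t` are.** -/
theorem isScalarMat_mul_iff {η : Mat q} (hη : ¬ HasRatEigenvalue η) {s t : G q} (hs : s ∈ splitTorus q)
    (ht : t ∈ nonsplitTorus η) :
    IsScalarMat ((s * t : G q) : Mat q) ↔ IsScalarMat (s : Mat q) ∧ IsScalarMat (t : Mat q) := by
  simp only [splitTorus, Finset.mem_filter, Finset.mem_univ, true_and] at hs
  obtain ⟨hs01, hs10⟩ := hs
  have hs00 : (s : Mat q) 0 0 ≠ 0 := by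
    intro h0
    have hdet : (s : Mat q).det = 0 := by rw [Matrix.det_fin_two, h0, hs01]; ring
    have hu : IsUnit (s : Mat q).det := by rw [← Matrix.isUnit_iff_isUnit_det]; exact Units.isUnit s
    exact hu.ne_zero hdet
  have e01 : ((s * t : G q) : Mat q) 0 1 = (s : Mat q) 0 0 * (t : Mat q) 0 1 := by
    simp [Units.val_mul, Matrix.mul_apply, Fin.sum_univ_two, hs01]
  have e10 : ((s * t : G q) : Mat q) 1 0 = (s : Mat q) 1 1 * (t : Mat q) 1 0 := by
    simp [Units.val_mul, Matrix.mul_apply, Fin.sum_univ_two, hs10]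
  have e00 : ((s * t : G q) : Mat q) 0 0 = (s : Mat q) 0 0 * (t : Mat q) 0 0 := by
    simp [Units.val_mul, Matrix.mul_apply, Fin.sum_univ_two, hs01]
  have e11 : ((s * t : G q) : Mat q) 1 1 = (s : Mat q) 1 1 * (t : Mat q) 1 1 := by
    simp [Units.val_mul, Matrix.mul_apply, Fin.sum_univ_two, hs10]
  constructor
  · rintro ⟨h01, h10, h00⟩
    rw [e01] at h01
    have ht01 : (t : Mat q) 0 1 = 0 := by
      rcases mul_eq_zero.1 h01 with h | h
      · exact absurd h hs00
      · exact h
    have htsc := isScalarMat_of_mem_torus_of_entry01 hη ht ht01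
    refine ⟨⟨hs01, hs10, ?_⟩, htsc⟩
    obtain ⟨-, -, htt⟩ := htsc
    rw [e00, e11, ← htt] at h00
    have ht00 : (t : Mat q) 0 0 ≠ 0 := by
      intro h0
      have hdet : (t : Mat q).det = 0 := by rw [Matrix.det_fin_two, h0, ht01]; ring
      have hu : IsUnit (t : Mat q).det := by rw [← Matrix.isUnit_iff_isUnit_det]; exact Units.isUnit t
      exact hu.ne_zero hdet
    exact mul_right_cancel₀ ht00 h00
  · rintro ⟨⟨-, -, hss⟩, ⟨ht01, ht10, htt⟩⟩
    refine ⟨?_, ?_, ?_⟩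
    · rw [e01, ht01, mul_zero]
    · rw [e10, ht10, mul_zero]
    · rw [e00, e11, hss, htt]

/-- the scalar elements of the split torus number `q − 1`. -/
theorem card_scalar_splitTorus :
    ((splitTorus q).filter (fun s : G q => IsScalarMat (s : Mat q))).card = q - 1 := by
  have hset : (splitTorus q).filter (fun s : G q => IsScalarMat (s : Mat q)) =
      (Finset.univ : Finset (ZMod q)ˣ).image (fun a => diagGL (fun _ : Fin 2 => a)) := by
    ext s
    simp only [Finset.mem_filter, Finset.mem_image, Finset.mem_univ, true_and, splitTorus_eq_image]
    constructor
    · rintro ⟨⟨u, rfl⟩, hsc⟩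
      obtain ⟨-, -, h00⟩ := hsc
      rw [diagGL_coe] at h00
      simp only [Matrix.diagonal_apply_eq] at h00
      refine ⟨u 0, ?_⟩
      congr 1
      funext i
      fin_cases i
      · rfl
      · exact Units.ext h00
    · rintro ⟨a, rfl⟩
      refine ⟨⟨fun _ => a, rfl⟩, ?_⟩
      rw [diagGL_coe]
      refine ⟨?_, ?_, ?_⟩ <;> simp [Matrix.diagonal]
  rw [hset, Finset.card_image_of_injective, Finset.card_univ, ZMod.card_units]
  intro a b h
  have := congrFun (diagGL_injective h) 0
  exact this

/-- the scalar elements of `T_C³` are those of `T_C`, `q − 1` of them (`q ≡ 2 (3)`). -/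
theorem card_scalar_nonsplitCubes {η : Mat q} (hη : ¬ HasRatEigenvalue η) (hq5 : 5 ≤ q) (hq3 : q % 3 = 2) :
    ((nonsplitCubes η).filter (fun t : G q => IsScalarMat (t : Mat q))).card = q - 1 := by
  have hsc : (nonsplitCubes η).filter (fun t : G q => IsScalarMat (t : Mat q)) =
      (nonsplitTorus η).filter (fun t : G q => IsScalarMat (t : Mat q)) := by
    ext t
    simp only [Finset.mem_filter]
    constructor
    · rintro ⟨ht, hs⟩; exact ⟨nonsplitCubes_subset η ht, hs⟩
    · rintro ⟨ht, hs⟩; exact ⟨scalar_mem_nonsplitCubes hη hq5 hq3 ht hs, hs⟩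
  rw [hsc, card_scalar_nonsplitTorus hη]

/-- **the number of pairs `(s,t) ∈ T_s × T_C³` with `s·t` scalar is `(q − 1)²`** (`q ≡ 2 (3)`). -/
theorem card_scalar_pairs {η : Mat q} (hη : ¬ HasRatEigenvalue η) (hq5 : 5 ≤ q) (hq3 : q % 3 = 2) :
    ∑ s ∈ splitTorus q, ∑ t ∈ nonsplitCubes η, (if IsScalarMat ((s * t : G q) : Mat q) then 1 else 0 : ℕ) =
      (q - 1) * (q - 1) := by
  rw [← Finset.sum_product', Finset.sum_boole]
  have hset : (splitTorus q ×ˢ nonsplitCubes η).filter (fun p : G q × G q => IsScalarMat ((p.1 * p.2 : G q) : Mat q)) =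
      ((splitTorus q).filter (fun s : G q => IsScalarMat (s : Mat q))) ×ˢ
        ((nonsplitCubes η).filter (fun t : G q => IsScalarMat (t : Mat q))) := by
    ext p
    simp only [Finset.mem_filter, Finset.mem_product]
    constructor
    · rintro ⟨⟨hs, ht⟩, hsc⟩
      obtain ⟨h1, h2⟩ := (isScalarMat_mul_iff hη hs (nonsplitCubes_subset η ht)).1 hsc
      exact ⟨⟨hs, h1⟩, ⟨ht, h2⟩⟩
    · rintro ⟨⟨hs, h1⟩, ⟨ht, h2⟩⟩
      exact ⟨⟨hs, ht⟩, (isScalarMat_mul_iff hη hs (nonsplitCubes_subset η ht)).2 ⟨h1, h2⟩⟩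
  simp only [Nat.cast_id]
  rw [hset, Finset.card_product, card_scalar_splitTorus, card_scalar_nonsplitCubes hη hq5 hq3]

end

end Summit.BirchSwinnertonDyer.BirchSwinnertonDyer.Theorems.CartanTorusCubeCut
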